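import Literature.LinearAlgebra.RootSystem.AffineWeylGroupSimplyTransitive
import Literature.LinearAlgebra.RootSystem.ParabolicLongestElement
import Literature.LinearAlgebra.RootSystem.RootSubpairing
import Literature.LinearAlgebra.RootSystem.WeylGroupPoincarePolynomial
import HarnessLib

/-!
# The linear part of an element of `Ω`: `ρ = T(ε_i) w_{Π(i)} w_Π` (Iwahori–Matsumoto 1965 Proposition 1.18; Bourbaki VI §2 no. 3 Prop. 6)

N. Iwahori, H. Matsumoto, *On some Bruhat decomposition and the structure of the Hecke rings of p-adic Chevalley groups*, Publ. Math. IHÉS 25 (1965)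
[IwahoriMatsumoto1965] (held `paper:doi-10-1007-bf02684396`, p0013 = p. 248), §1.7: «Now let us give an explicit description of `Ω`. Let `σ = T(d)w ∈ DW`
be an element of `Ω` where `d ∈ P^⊥`, `w ∈ W`. Assume `σ ≠ 1`. … Hence `d = ε_i` with some `ε_i` such that `(α₀, ε_i) = 1`. Note that `w` is uniquely
determined by `d`. … It is known that there exists in `W` an element `w_Π` such that `w_Π Π = -Π` … Similarly, if we denote the subset `Π - {α_i}` by
`Π_i`, then the subgroup `W_i` of `W` generated by `w_1, …, ŵ_i, …, w_l` contains an element `w_{Π_i}` such that `w_{Π_i}(Π_i) = -Π_i`. `w_{Π_i}` is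
uniquely determined in `W_i` and satisfies `w_{Π_i}² = 1`. We claim that `T(ε_i) w_{Π_i} w_Π ∈ Ω`, i.e. `T(ε_i) w_{Π_i} w_Π(𝔇∘) = 𝔇∘` … **Proposition 1.18.**
The mapping from the set `{0} ∪ {ε_i; (α₀, ε_i) = 1}` onto `Ω` defined by `0 → 1`, `ε_i → T(ε_i) w_{Π(i)} w_Π` is bijective.»

N. Bourbaki, *Lie Groups and Lie Algebras, Chapters 4–6* [Bourbaki2002LieGroups46], Ch. VI §2 no. 3 Proposition 6 (cite-only): the element of `W`
attached to a minuscule coweight `ϖ_i` is `w_i w_0`, `w_0` the longest element of `W` and `w_i` that of the Weyl group of `{α_j}_{j ≠ i}`.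

THIS FILE (lane `lit-hodgefound`, prover seat p40, generation 47, row g47-#5; THEOREMS ONLY — no definition, instance, notation or named fact; net
debt 0) supplies the `W`-part of Proposition 1.18, which row g45-#7 (`AffineWeylGroupOmegaSpecialNodes`) left aside («the description of the `W`-part
`w_{Π(i)} w_Π` of IM's element (longest elements) is not given»): in the conventions of the `AffineWeylGroup*` files (weight space `M`, coroot levels,
`Ŵ_a = T_{P(Φ)} ⋊ W`, `Ω = {o ∈ Ŵ_a | oA∘ = A∘}`; IM's `ε_i` are the minuscule fundamental WEIGHTS `ϖ_j`, `⟨ϖ_j, α_k^∨⟩ = δ_{jk}` on `Δ`, row g45-#7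
`coroot'_apply_zero_of_perm_none_eq_some`) — if `o = t(v)·g ∈ Ω` with `g ∈ W` and `v = o(0)` of simple levels `δ_{jk}`, then
`g = w_{Δ∖{j}} · w₀`, where `w₀` is the longest element of `W` (row g36: «an element of `W` sending `Φ⁺` into `Φ⁻`») and `w_{Δ∖{j}}` the longest
element of the parabolic subgroup `W_{Δ∖{j}}` (row g40-#4: `w ∈ ⟨s_k : k ≠ j⟩` sending `Φ⁺_{Δ∖{j}}` into `Φ⁻`).

* §1 ★★ **`coroot'_eq_zero_iff_root_mem_span_of_isPos`** (for such `v` and `α ≻ 0`: `⟨v, α^∨⟩ = 0 ⟺ α ∈ Φ_{Δ∖{j}}`, i.e. `α` does not involve `α_j`;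
  positive coroots are sums of simple coroots — Mathlib `IsPos.induction_on_add` for `b.flip` — and `Φ_I`, `Φ_I^∨` have the same span condition, tree
  `coroot_mem_span_of_root_mem_span` for `P` and `P.flip`), ★ **`coroot'_nonneg_and_coroot_mem_span_of_isPos`** (`⟨v, α^∨⟩ ≥ 0` on `Φ⁺`, and the
  coroot version), `toLinearMap_eq_zero_of_mem_span_coroot_sdiff`.
* §2 ★★ **`isPos_longest_mul_longest_smul_iff`** (for `α ≻ 0`: `(w₀ w_{Δ∖{j}}) α ≻ 0 ⟺ α ∈ Φ_{Δ∖{j}}` — `w_{Δ∖{j}}` negates `Φ⁺_{Δ∖{j}}` and permutes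
  `Φ⁺ ∖ Φ_{Δ∖{j}}`, `w₀` exchanges `Φ⁺` and `Φ⁻`).
* §3 ★★★ **`inv_eq_longest_mul_longest`** ∕ ★★★ **`eq_longest_mul_longest`** (PROPOSITION 1.18, THE `W`-PART: `g⁻¹ = w₀ w_{Δ∖{j}}` and `g = w_{Δ∖{j}} w₀`
  — both sides lie in `W` and make the same positive roots negative, row g37-#5 `eq_of_forall_isPos_smul_iff`; the sign pattern of `g⁻¹` is row g44-#8's
  `g⁻¹α ≻ 0 ⟺ ⟨v, α^∨⟩ = 0`), ★★ **`eq_constVAdd_mul_longest_mul_longest`** (`o = t(ϖ_j) · w_{Δ∖{j}} w₀` as printed).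

BY NAME, nothing restated: rows g44-#1 (`affineHom`, `weightLattice`, `constVAdd_mul_affineHom_apply_zero`), g44-#8 (`forall_coroot'_mem_of_image_fundamentalAlcove_eq`),
g36 (`isPos_smul_of_not_isPos`, `inv_eq_self_of_forall_not_isPos_smul`, `smul_index_eq`), g37-#5 (`eq_of_forall_isPos_smul_iff`), g37 `ParabolicSubgroup`
(`closure_image_le_weylGroup`, `isPos_smul_iff_of_mem_closure_image_of_root_notMem_span`), g40-#4 (`longest_inv_eq`), g32 `WeylVector` (`flip_isPos_of_isPos`),
`RootSubpairing` (`coroot_mem_span_of_root_mem_span`); Mathlib `RootPairing.Base.flip`, `RootPairing.Base.IsPos.induction_on_add`, `Submodule.span_le`,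
`Submodule.span_induction`.

## Scope caveats

The existence of `o ∈ Ω` over each special node and the values `o(0) = ϖ_j` are rows g44-#8 ∕ g45-#7 and are taken as hypotheses here (`hA`, `hv`);
`w₀`, `w_{Δ∖{j}}` are carried as hypotheses (the tree's `existsUnique_longest`, `existsUnique_longest_mem_closure_image` supply them). Finite reduced
crystallographic root systems over an ordered field of characteristic zero, `η` with `hη` (highest coroot).

## References

* [IwahoriMatsumoto1965] N. Iwahori, H. Matsumoto, Publ. Math. IHÉS 25 (1965) 5–48, §1.7 Proposition 1.18 and its proof (p. 248).
* [Bourbaki2002LieGroups46] N. Bourbaki, *Lie Groups and Lie Algebras, Chapters 4–6*, Springer (2002), Ch. VI §2 no. 3 Prop. 6 (cite-only).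
* [Humphreys1990] J. E. Humphreys, *Reflection Groups and Coxeter Groups*, CUP (1990), §1.8 (`w₀`), §1.10 (`W_I`), §4.5 (`Ω`) (cite-only).
-/

noncomputable section

open Module Set Function Submodule

namespace Literature.LinearAlgebra.RootSystem

namespace Base

variable {ι K M N : Type*} [Field K] [LinearOrder K] [IsStrictOrderedRing K] [AddCommGroup M] [Module K M]
  [AddCommGroup N] [Module K N] [Fintype ι] [DecidableEq ι]
  {P : RootPairing ι K M N} [CharZero K] [P.IsCrystallographic] [P.IsReduced] (b : P.Base)

/-! ## §1 For `⟨v, α_k^∨⟩ = δ_{jk}` on `Δ`: `⟨v, α^∨⟩ = 0 ⟺ α ∈ Φ_{Δ∖{j}}` (`α ≻ 0`) -/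

section Levels

variable {j : b.support} {v : M} (hv : ∀ k : b.support, P.coroot' k v = if k = j then 1 else 0)

include hv

omit [LinearOrder K] [IsStrictOrderedRing K] [Fintype ι] [CharZero K] [P.IsCrystallographic] [P.IsReduced] in
/-- `⟨v, ·⟩` kills the span of the coroots `α_k^∨`, `k ∈ Δ ∖ {j}`. [cite: IwahoriMatsumoto1965, §1.7 proof of Proposition 1.18 ("W_{Π_i}(α_l) = α_l + Σ ν_{lj} α_j")] -/
theorem toLinearMap_eq_zero_of_mem_span_coroot_sdiff {y : N}
    (hy : y ∈ span K (P.coroot '' (((b.support : Set ι)) \ {(j : ι)}))) : P.toLinearMap v y = 0 := by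
  induction hy using Submodule.span_induction with
  | mem y hy =>
    obtain ⟨k, ⟨hk, hkj⟩, rfl⟩ := hy
    have h := hv ⟨k, hk⟩
    have hne : (⟨k, hk⟩ : b.support) ≠ j := fun h' ↦ hkj (mem_singleton_iff.mpr (by rw [← h']))
    rw [if_neg hne] at h
    exact h
  | zero => rw [map_zero]
  | add y z _ _ hy hz => rw [map_add, hy, hz, add_zero]
  | smul c y _ hy => rw [map_smul, hy, smul_zero]

/-- ★ **`⟨v, α^∨⟩ ≥ 0` ON `Φ⁺` AND `⟨v, α^∨⟩ = 0 ⟹ α^∨ ∈ span Φ^∨_{Δ∖{j}}`** — a positive coroot is a sum of simple coroots (Mathlib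
`IsPos.induction_on_add` for the flipped base), each with level `δ_{jk} ≥ 0`. [cite: IwahoriMatsumoto1965, §1.7 proof of Proposition 1.18] -/
theorem coroot'_nonneg_and_coroot_mem_span_of_isPos {i : ι} (hi : b.IsPos i) :
    0 ≤ P.coroot' i v ∧ (P.coroot' i v = 0 → P.coroot i ∈ span K (P.coroot '' (((b.support : Set ι)) \ {(j : ι)}))) := by
  have hi' : b.flip.IsPos i := flip_isPos_of_isPos hi
  refine hi'.induction_on_add (p := fun k ↦ 0 ≤ P.coroot' k v ∧
      (P.coroot' k v = 0 → P.coroot k ∈ span K (P.coroot '' (((b.support : Set ι)) \ {(j : ι)})))) ?_ ?_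
  · intro k hk
    have hk' : k ∈ b.support := by simpa using hk
    have h := hv ⟨k, hk'⟩
    by_cases hkj : (⟨k, hk'⟩ : b.support) = j
    · rw [if_pos hkj] at h
      exact ⟨by rw [h]; exact zero_le_one, fun h0 ↦ absurd (h.symm.trans h0) one_ne_zero⟩
    · rw [if_neg hkj] at h
      refine ⟨h.ge, fun _ ↦ subset_span ⟨k, ⟨hk', fun hk0 ↦ hkj (Subtype.ext (mem_singleton_iff.mp hk0))⟩, rfl⟩⟩
  · intro k m l hl hk hm
    have hl' : P.coroot l = P.coroot k + P.coroot m := by simpa only [RootPairing.flip_root] using hl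
    have hm' : m ∈ b.support := by simpa using hm
    have hlev : P.coroot' l v = P.coroot' k v + P.coroot' m v := by
      change P.toLinearMap v (P.coroot l) = P.toLinearMap v (P.coroot k) + P.toLinearMap v (P.coroot m)
      rw [hl', map_add]
    have hmv : 0 ≤ P.coroot' m v := by
      have h := hv ⟨m, hm'⟩
      by_cases hmj : (⟨m, hm'⟩ : b.support) = j
      · rw [if_pos hmj] at h; rw [h]; exact zero_le_one
      · rw [if_neg hmj] at h; rw [h]
    refine ⟨by rw [hlev]; exact add_nonneg hk.1 hmv, fun h0 ↦ ?_⟩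
    rw [hlev] at h0
    have hk0 : P.coroot' k v = 0 := le_antisymm (by linarith [hk.1]) hk.1
    have hm0 : P.coroot' m v = 0 := by linarith
    rw [hl']
    refine add_mem (hk.2 hk0) (subset_span ⟨m, ⟨hm', fun hmj ↦ ?_⟩, rfl⟩)
    have h := hv ⟨m, hm'⟩
    rw [if_pos (Subtype.ext (mem_singleton_iff.mp hmj)), hm0] at h
    exact zero_ne_one h

/-- ★★ **`⟨v, α^∨⟩ = 0 ⟺ α ∈ Φ_{Δ∖{j}}` FOR `α ≻ 0`** (`Φ_I = Φ ∩ span Φ(I)` as in the tree's `ParabolicSubgroup`): the positive roots orthogonal to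
`ϖ_j` are those not involving `α_j` (the coroot statement of the previous lemma transported to roots by the tree's `coroot_mem_span_of_root_mem_span`
for `P` and for `P.flip`). [cite: IwahoriMatsumoto1965, §1.7 proof of Proposition 1.18 ("since W_{Π_i} is a product of the w_j's with j ≠ i, we have W_{Π_i}(α_l) = α_l + Σ_{j≠i} ν_{lj} α_j")] -/
theorem coroot'_eq_zero_iff_root_mem_span_of_isPos {i : ι} (hi : b.IsPos i) :
    P.coroot' i v = 0 ↔ P.root i ∈ span K (P.root '' (((b.support : Set ι)) \ {(j : ι)})) := by
  have hJ : ((b.support : Set ι)) \ {(j : ι)} ⊆ (b.support : Set ι) := fun x hx ↦ hx.1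
  constructor
  · intro h0
    have h1 := (coroot'_nonneg_and_coroot_mem_span_of_isPos b hv hi).2 h0
    -- `Φ_I^∨ ↦ Φ_I`: the tree's lemma for the flipped pairing
    have hJ' : ((b.support : Set ι)) \ {(j : ι)} ⊆ (b.flip.support : Set ι) := by
      rw [RootPairing.Base.flip_support]; exact hJ
    have h1' : P.flip.root i ∈ span K (P.flip.root '' (((b.support : Set ι)) \ {(j : ι)})) := by
      simpa only [RootPairing.flip_root] using h1
    have h2 : P.flip.coroot i ∈ span K (P.flip.coroot '' (((b.support : Set ι)) \ {(j : ι)})) :=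
      coroot_mem_span_of_root_mem_span b.flip hJ' h1'
    simpa only [RootPairing.flip_coroot] using h2
  · intro hmem
    exact toLinearMap_eq_zero_of_mem_span_coroot_sdiff b hv (coroot_mem_span_of_root_mem_span b hJ hmem)

end Levels

/-! ## §2 The sign pattern of `w₀ w_{Δ∖{j}}` -/

section Longest

variable {j : b.support}
  {w₀ : P.Aut} (hw₀' : ∀ i, b.IsPos i → ¬ b.IsPos (w₀ • i))
  {wJ : P.Aut} (hwJ : wJ ∈ Subgroup.closure (RootPairing.Equiv.reflection P '' (((b.support : Set ι)) \ {(j : ι)})))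
  (hwJ' : ∀ i, b.IsPos i → P.root i ∈ span K (P.root '' (((b.support : Set ι)) \ {(j : ι)})) → ¬ b.IsPos (wJ • i))

include hw₀' hwJ hwJ'

omit [LinearOrder K] [IsStrictOrderedRing K] [DecidableEq ι] in
/-- ★★ **FOR `α ≻ 0`: `(w₀ w_{Δ∖{j}}) α ≻ 0 ⟺ α ∈ Φ_{Δ∖{j}}`** — `w_{Δ∖{j}}` sends `Φ⁺_{Δ∖{j}}` into `Φ⁻` and keeps the other positive roots positive
(tree, rows g37 ∕ g40-#4), and `w₀` exchanges positive and negative roots. [cite: IwahoriMatsumoto1965, §1.7 proof of Proposition 1.18 ("W_Π(Π) = −Π … W_{Π_i}(Π_i) = −Π_i … W_{Π_i}(α_i) > 0")] -/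
theorem isPos_longest_mul_longest_smul_iff {i : ι} (hi : b.IsPos i) :
    b.IsPos ((w₀ * wJ) • i) ↔ P.root i ∈ span K (P.root '' (((b.support : Set ι)) \ {(j : ι)})) := by
  have hJ : ((b.support : Set ι)) \ {(j : ι)} ⊆ (b.support : Set ι) := fun x hx ↦ hx.1
  rw [mul_smul]
  by_cases hmem : P.root i ∈ span K (P.root '' (((b.support : Set ι)) \ {(j : ι)}))
  · simp only [hmem, iff_true]
    exact isPos_smul_of_not_isPos b hw₀' (hwJ' i hi hmem)
  · simp only [hmem, iff_false]
    exact hw₀' _ ((isPos_smul_iff_of_mem_closure_image_of_root_notMem_span b hJ hwJ hmem).mpr hi)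

end Longest

/-! ## §3 Proposition 1.18: the linear part of `o ∈ Ω` over the special node `j` is `w_{Δ∖{j}} w₀` -/

section Omega

variable [Nonempty ι] {η : ι} (hη : ∀ k, P.coroot η - P.coroot k ∈ AddSubmonoid.closure (P.coroot '' (b.support : Set ι)))
  {v : M} (hvP : v ∈ weightLattice P) {g : P.Aut} (hg : g ∈ P.weylGroup)
  (hA : (AffineEquiv.constVAdd K M v * affineHom P g) '' {x : M | ∀ i, b.IsPos i → 0 < P.coroot' i x ∧ P.coroot' i x < 1} =
    {x : M | ∀ i, b.IsPos i → 0 < P.coroot' i x ∧ P.coroot' i x < 1})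
  {j : b.support} (hv : ∀ k : b.support, P.coroot' k v = if k = j then 1 else 0)
  {w₀ : P.Aut} (hw₀ : w₀ ∈ P.weylGroup) (hw₀' : ∀ i, b.IsPos i → ¬ b.IsPos (w₀ • i))
  {wJ : P.Aut} (hwJ : wJ ∈ Subgroup.closure (RootPairing.Equiv.reflection P '' (((b.support : Set ι)) \ {(j : ι)})))
  (hwJ' : ∀ i, b.IsPos i → P.root i ∈ span K (P.root '' (((b.support : Set ι)) \ {(j : ι)})) → ¬ b.IsPos (wJ • i))

include hη hvP hg hA hv hw₀ hw₀' hwJ hwJ'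

/-- ★★★ **`g⁻¹ = w₀ · w_{Δ∖{j}}`** for `o = t(v)·g ∈ Ω` with `o(0) = v = ϖ_j`: for `α ≻ 0`, `g⁻¹α ≻ 0 ⟺ ⟨v, α^∨⟩ = 0` (row g44-#8, comparing the
floor data of `oA∘ = A∘`) `⟺ α ∈ Φ_{Δ∖{j}}` (§1) `⟺ (w₀ w_{Δ∖{j}}) α ≻ 0` (§2), and an element of `W` is determined by the positive roots it keeps
positive (row g37-#5). [cite: IwahoriMatsumoto1965, §1.7 Proposition 1.18 ("ε_i → T(ε_i) w_{Π(i)} w_Π … w is uniquely determined by d")] [cite: Bourbaki2002LieGroups46, Ch. VI §2 no. 3 Prop. 6] -/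
theorem inv_eq_longest_mul_longest : g⁻¹ = w₀ * wJ := by
  have hJ : ((b.support : Set ι)) \ {(j : ι)} ⊆ (b.support : Set ι) := fun x hx ↦ hx.1
  have h3 := (forall_coroot'_mem_of_image_fundamentalAlcove_eq b hη hvP g hA).2.2
  refine eq_of_forall_isPos_smul_iff b (inv_mem hg) (mul_mem hw₀ (closure_image_le_weylGroup _ hwJ)) fun i hi ↦ ?_
  rw [h3 i hi, coroot'_eq_zero_iff_root_mem_span_of_isPos b hv hi, isPos_longest_mul_longest_smul_iff b hw₀' hwJ hwJ' hi]

/-- ★★★ **PROPOSITION 1.18, THE `W`-PART: `g = w_{Δ∖{j}} · w₀`** («`ε_i → T(ε_i) w_{Π(i)} w_Π`»; both longest elements are involutions, rows g36 ∕ g40-#4).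
[cite: IwahoriMatsumoto1965, §1.7 Proposition 1.18 ("The mapping … ε_i → T(ε_i) w_{Π(i)} w_Π is bijective")] [cite: Bourbaki2002LieGroups46, Ch. VI §2 no. 3 Prop. 6] -/
theorem eq_longest_mul_longest : g = wJ * w₀ := by
  have hJ : ((b.support : Set ι)) \ {(j : ι)} ⊆ (b.support : Set ι) := fun x hx ↦ hx.1
  have h := congrArg (·⁻¹) (inv_eq_longest_mul_longest b hη hvP hg hA hv hw₀ hw₀' hwJ hwJ')
  simp only [inv_inv, mul_inv_rev] at h
  rw [h, longest_inv_eq b hJ hwJ hwJ', inv_eq_self_of_forall_not_isPos_smul b hw₀ hw₀']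

/-- ★★ **`o = T(ϖ_j) · w_{Δ∖{j}} w₀` AS PRINTED.** [cite: IwahoriMatsumoto1965, §1.7 Proposition 1.18 ("ε_i → T(ε_i) w_{Π(i)} w_Π")] -/
theorem eq_constVAdd_mul_longest_mul_longest :
    AffineEquiv.constVAdd K M v * affineHom P g = AffineEquiv.constVAdd K M v * affineHom P (wJ * w₀) := by
  rw [← eq_longest_mul_longest b hη hvP hg hA hv hw₀ hw₀' hwJ hwJ']

end Omega

end Base

end Literature.LinearAlgebra.RootSystem
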